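import Summits.AtomisticToContinuum.FouriersLaw.Theorems.HonestZwanzigRobinCoercivityStubImsLocalisation

/-!
# `HonestZwanzig.RobinCoercivity`, line `limit-operator-memory-form` — the IMS engine (part A of the transfer)

Support file for the crux `stmt-AtomisticToContinuum-12695` (`RobinCoercivity` of route `HonestZwanzig`, sub-problem
`FouriersLaw`), line card `Cruxes/RobinCoercivity/Lines/limit-operator-memory-form.md`. Pure finite-dimensional real
analysis: elementary constants (`exists_pos_le_finite`, `exists_natL`, `exists_small_tail`), the off-band commutator input
of the IMS step (`commutator_input`), coercivity of a bulk window from a Toeplitz lower bound plus entrywise closeness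
(`bulk_window`), and the assembled statement `coercive_of_pieces`: band tails at `0` and `D`, entrywise bulk limit with
accuracy `m₁/(4L)` inside every window of width `2L`, Toeplitz bound `m₁`, corner coercivity `m₂` on windows of size
`R + 1 + 2L`, and smallness `(D²/L²)τ(0) + τ(D) ≤ c_w/10` give `W ⪰ c_w/2`, `c_w = min(m₁/2, m₂)`, through the landed
discrete IMS localisation formula `Robin.stub_imsLocalisation` with corner depth `A = R + 1`.
-/

noncomputable section

open Finset Filter Topology

namespace Summit.AtomisticToContinuum.FouriersLaw.Theorems.HonestZwanzig.Robin

/-! ### Elementary helpers -/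

/-- A positive constant below `c₀` and below finitely many positive constants `f 0, …, f (N₁−1)`. -/
theorem exists_pos_le_finite (c₀ : ℝ) (hc₀ : 0 < c₀) (f : ℕ → ℝ) (hf : ∀ n, 0 < f n) :
    ∀ N₁ : ℕ, ∃ c : ℝ, 0 < c ∧ c ≤ c₀ ∧ ∀ n, n < N₁ → c ≤ f n := by
  intro N₁
  induction N₁ with
  | zero => exact ⟨c₀, hc₀, le_rfl, fun n hn => absurd hn (Nat.not_lt_zero n)⟩
  | succ k ih =>
    obtain ⟨c, hc, hcc₀, hcf⟩ := ih
    refine ⟨min c (f k), lt_min hc (hf k), (min_le_left _ _).trans hcc₀, fun n hn => ?_⟩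
    rcases (Nat.lt_succ_iff.1 hn).lt_or_eq with h | h
    · exact (min_le_left _ _).trans (hcf n h)
    · subst h; exact min_le_right _ _

/-- The crux's Robin form is nonnegative. -/
theorem robinForm_nonneg {N : ℕ} (ξ : Fin N → ℝ) :
    0 ≤ (∑ i : Fin N, ((∑ j : Fin N, if j.val = i.val + 1 then (ξ j - ξ i) ^ 2 else 0) +
        (if i.val = 0 then ξ i ^ 2 else 0) + (if i.val = N - 1 then ξ i ^ 2 else 0))) := by
  refine Finset.sum_nonneg fun i _ => add_nonneg (add_nonneg (Finset.sum_nonneg fun j _ => ?_) ?_) ?_ <;>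
    split_ifs <;> positivity

/-- A localisation length: `L ≥ 1` with `a / L² ≤ b`. -/
theorem exists_natL (a b : ℝ) (ha : 0 ≤ a) (hb : 0 < b) : ∃ L : ℕ, 1 ≤ L ∧ a / (L : ℝ) ^ 2 ≤ b := by
  obtain ⟨n, hn⟩ := exists_nat_gt (a / b)
  refine ⟨n + 1, Nat.le_add_left 1 n, ?_⟩
  have hL : (1 : ℝ) ≤ ((n + 1 : ℕ) : ℝ) := by exact_mod_cast Nat.le_add_left 1 n
  have hLpos : (0 : ℝ) < ((n + 1 : ℕ) : ℝ) := by positivity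
  have hab : a ≤ b * ((n + 1 : ℕ) : ℝ) := by
    have h1 : a / b < ((n + 1 : ℕ) : ℝ) := by push_cast; linarith
    rw [div_lt_iff₀ hb] at h1
    nlinarith
  calc a / ((n + 1 : ℕ) : ℝ) ^ 2 ≤ a / ((n + 1 : ℕ) : ℝ) := by
        apply div_le_div_of_nonneg_left ha hLpos
        nlinarith
    _ ≤ b := by rw [div_le_iff₀ hLpos]; linarith

/-- From a null tail profile: some `D` with `τ D ≤ ε`. -/
theorem exists_small_tail (τ : ℕ → ℝ) (hτ : Tendsto τ atTop (𝓝 0)) (ε : ℝ) (hε : 0 < ε) :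
    ∃ D : ℕ, τ D ≤ ε := by
  obtain ⟨D, hD⟩ := Metric.tendsto_atTop.1 hτ ε hε
  refine ⟨D, ?_⟩
  have := hD D le_rfl
  rw [Real.dist_eq, sub_zero] at this
  exact (le_abs_self _).trans this.le

/-- The off-band commutator input of the IMS step from two tail bounds (`d = 0` and `d = D`):
`Σ_j min(1,(i−j)²/L²)|W_ij| ≤ (D²/L²)·τ(0) + τ(D)`. -/
theorem commutator_input {M : ℕ} (W : Fin M → Fin M → ℝ) (i : Fin M) (D L : ℕ) (hL : 1 ≤ L) (t0 tD : ℝ)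
    (h0 : ∑ j, (if ((0 : ℕ) : ℝ) < |(i.val : ℝ) - j.val| then |W i j| else 0) ≤ t0)
    (hD : ∑ j, (if (D : ℝ) < |(i.val : ℝ) - j.val| then |W i j| else 0) ≤ tD) :
    ∑ j, min 1 (((i.val : ℝ) - j.val) ^ 2 / (L : ℝ) ^ 2) * |W i j| ≤
      (D : ℝ) ^ 2 / (L : ℝ) ^ 2 * t0 + tD := by
  have hL' : (0 : ℝ) < (L : ℝ) ^ 2 := by
    have : (1 : ℝ) ≤ L := by exact_mod_cast hL
    positivity
  have hDL : 0 ≤ (D : ℝ) ^ 2 / (L : ℝ) ^ 2 := by positivity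
  calc ∑ j, min 1 (((i.val : ℝ) - j.val) ^ 2 / (L : ℝ) ^ 2) * |W i j|
      ≤ ∑ j, ((D : ℝ) ^ 2 / (L : ℝ) ^ 2 * (if ((0 : ℕ) : ℝ) < |(i.val : ℝ) - j.val| then |W i j| else 0) +
          (if (D : ℝ) < |(i.val : ℝ) - j.val| then |W i j| else 0)) := by
        refine Finset.sum_le_sum fun j _ => ?_
        have hW : 0 ≤ |W i j| := abs_nonneg _
        have hmin1 : min 1 (((i.val : ℝ) - j.val) ^ 2 / (L : ℝ) ^ 2) ≤ 1 := min_le_left _ _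
        have hmin0 : 0 ≤ min 1 (((i.val : ℝ) - j.val) ^ 2 / (L : ℝ) ^ 2) := le_min zero_le_one (by positivity)
        by_cases hD' : (D : ℝ) < |(i.val : ℝ) - j.val|
        · rw [if_pos hD']
          have h0' : ((0 : ℕ) : ℝ) < |(i.val : ℝ) - j.val| :=
            lt_of_le_of_lt (by simp) hD'
          rw [if_pos h0']
          nlinarith
        · rw [if_neg hD']
          push Not at hD'
          have hsq : ((i.val : ℝ) - j.val) ^ 2 ≤ (D : ℝ) ^ 2 := by
            rw [← sq_abs]
            exact pow_le_pow_left₀ (abs_nonneg _) hD' 2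
          by_cases h0' : ((0 : ℕ) : ℝ) < |(i.val : ℝ) - j.val|
          · rw [if_pos h0']
            have : min 1 (((i.val : ℝ) - j.val) ^ 2 / (L : ℝ) ^ 2) ≤ (D : ℝ) ^ 2 / (L : ℝ) ^ 2 :=
              (min_le_right _ _).trans (div_le_div_of_nonneg_right hsq hL'.le)
            nlinarith
          · rw [if_neg h0']
            push Not at h0'
            have habs : |(i.val : ℝ) - j.val| = 0 := le_antisymm (by simpa using h0') (abs_nonneg _)
            have : ((i.val : ℝ) - j.val) ^ 2 / (L : ℝ) ^ 2 = 0 := by rw [← sq_abs, habs]; simp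
            rw [this]; simp
    _ = (D : ℝ) ^ 2 / (L : ℝ) ^ 2 * ∑ j, (if ((0 : ℕ) : ℝ) < |(i.val : ℝ) - j.val| then |W i j| else 0) +
          ∑ j, (if (D : ℝ) < |(i.val : ℝ) - j.val| then |W i j| else 0) := by
        rw [Finset.sum_add_distrib, Finset.mul_sum]
    _ ≤ _ := add_le_add (mul_le_mul_of_nonneg_left h0 hDL) hD

/-- Coercivity of a bulk window from the Toeplitz bound and the entrywise bulk limit: if `Σ v_iK(i−j)v_j ≥ m₁|v|²` and
`|W_ij − K(i−j)| ≤ ε` on the window `[a, a+2L)`, then `vᵀWv ≥ (m₁ − 2Lε)|v|²` for `v` supported there (Cauchy–Schwarz). -/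
theorem bulk_window {M : ℕ} (W : Fin M → Fin M → ℝ) (K : ℤ → ℝ) (m₁ ε : ℝ) (a L : ℕ)
    (hToe : ∀ v : Fin M → ℝ, m₁ * ∑ i, v i ^ 2 ≤ ∑ i, ∑ j, v i * K ((i.val : ℤ) - j.val) * v j)
    (hent : ∀ i j : Fin M, a ≤ i.val → i.val < a + 2 * L → a ≤ j.val → j.val < a + 2 * L →
      |W i j - K ((i.val : ℤ) - j.val)| ≤ ε)
    (hε : 0 ≤ ε) (v : Fin M → ℝ) (hv : ∀ i : Fin M, i.val < a ∨ a + 2 * L ≤ i.val → v i = 0) :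
    (m₁ - 2 * L * ε) * ∑ i, v i ^ 2 ≤ ∑ i, ∑ j, v i * W i j * v j := by
  classical
  set S : Finset (Fin M) := Finset.univ.filter (fun i : Fin M => a ≤ i.val ∧ i.val < a + 2 * L) with hS
  have hvS : ∀ i, i ∉ S → v i = 0 := by
    intro i hi
    apply hv i
    simp only [hS, Finset.mem_filter, Finset.mem_univ, true_and, not_and, not_lt] at hi
    omega
  have hcard : (S.card : ℝ) ≤ 2 * L := by
    have h1 : S.card ≤ (Finset.Ico a (a + 2 * L)).card := by
      rw [← Finset.card_image_of_injective S Fin.val_injective]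
      apply Finset.card_le_card
      intro n hn
      simp only [Finset.mem_image, hS, Finset.mem_filter, Finset.mem_univ, true_and] at hn
      obtain ⟨i, ⟨h1, h2⟩, rfl⟩ := hn
      simp [h1, h2]
    rw [Nat.card_Ico] at h1
    have : ((S.card : ℕ) : ℝ) ≤ ((a + 2 * L - a : ℕ) : ℝ) := by exact_mod_cast h1
    simpa using this
  have hsplit : ∑ i, ∑ j, v i * W i j * v j =
      (∑ i, ∑ j, v i * K ((i.val : ℤ) - j.val) * v j) +
        ∑ i, ∑ j, v i * (W i j - K ((i.val : ℤ) - j.val)) * v j := by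
    rw [← Finset.sum_add_distrib]
    refine Finset.sum_congr rfl fun i _ => ?_
    rw [← Finset.sum_add_distrib]
    refine Finset.sum_congr rfl fun j _ => ?_
    ring
  have herr : -(ε * (∑ i, |v i|) ^ 2) ≤ ∑ i, ∑ j, v i * (W i j - K ((i.val : ℤ) - j.val)) * v j := by
    have hexp : ε * (∑ i, |v i|) ^ 2 = ∑ i, ∑ j, ε * (|v i| * |v j|) := by
      rw [sq, Finset.sum_mul_sum, Finset.mul_sum]
      refine Finset.sum_congr rfl fun i _ => ?_
      rw [Finset.mul_sum]
    rw [hexp, ← Finset.sum_neg_distrib]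
    refine Finset.sum_le_sum fun i _ => ?_
    rw [← Finset.sum_neg_distrib]
    refine Finset.sum_le_sum fun j _ => ?_
    by_cases hi : v i = 0
    · simp [hi]
    by_cases hj : v j = 0
    · simp [hj]
    have hiS : a ≤ i.val ∧ i.val < a + 2 * L := by
      by_contra h
      exact hi (hv i (by omega))
    have hjS : a ≤ j.val ∧ j.val < a + 2 * L := by
      by_contra h
      exact hj (hv j (by omega))
    have hb := hent i j hiS.1 hiS.2 hjS.1 hjS.2
    have habs : |v i * (W i j - K ((i.val : ℤ) - j.val)) * v j| ≤ ε * (|v i| * |v j|) := by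
      rw [abs_mul, abs_mul]
      calc |v i| * |W i j - K ((i.val : ℤ) - j.val)| * |v j| ≤ |v i| * ε * |v j| := by gcongr
        _ = ε * (|v i| * |v j|) := by ring
    linarith [neg_abs_le (v i * (W i j - K ((i.val : ℤ) - j.val)) * v j)]
  have hCS : (∑ i, |v i|) ^ 2 ≤ 2 * L * ∑ i, v i ^ 2 := by
    have hsumS : ∑ i ∈ S, |v i| = ∑ i, |v i| :=
      Finset.sum_subset (Finset.subset_univ S) fun i _ hi => by simp [hvS i hi]
    have hsumS2 : ∑ i ∈ S, v i ^ 2 ≤ ∑ i, v i ^ 2 :=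
      Finset.sum_le_sum_of_subset_of_nonneg (Finset.subset_univ S) fun i _ _ => sq_nonneg _
    have hnn : 0 ≤ ∑ i, v i ^ 2 := Finset.sum_nonneg fun i _ => sq_nonneg _
    rw [← hsumS]
    calc (∑ i ∈ S, |v i|) ^ 2 = (∑ i ∈ S, |v i| * 1) ^ 2 := by simp
      _ ≤ (∑ i ∈ S, |v i| ^ 2) * ∑ i ∈ S, (1 : ℝ) ^ 2 :=
          Finset.sum_mul_sq_le_sq_mul_sq S (fun i => |v i|) (fun _ => 1)
      _ = (∑ i ∈ S, v i ^ 2) * S.card := by simp [sq_abs]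
      _ ≤ (∑ i, v i ^ 2) * (2 * L) := by
          apply mul_le_mul hsumS2 hcard (by positivity) hnn
      _ = 2 * L * ∑ i, v i ^ 2 := by ring
  have hT := hToe v
  have h2 := mul_le_mul_of_nonneg_left hCS hε
  rw [hsplit]
  nlinarith [hT, herr, h2]

/-! ### The IMS application at fixed `(N, s)` -/

/-- **Coercivity of the block matrix from the pieces** (abstract `W : Fin (N+1) → Fin (N+1) → ℝ`): band tails at `0` and
`D`, the entrywise bulk limit with accuracy `m₁/(4L)` on the bulk region, the Toeplitz bound `m₁`, corner coercivity `m₂`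
on windows of size `R + 1 + 2L`, and the smallness `(D²/L²)τ(0) + τ(D) ≤ c_w/10` give `W ⪰ c_w/2`, `c_w = min(m₁/2, m₂)`,
through `stub_imsLocalisation` with `A = R + 1`. -/
theorem coercive_of_pieces {N : ℕ} (W : Fin (N + 1) → Fin (N + 1) → ℝ) (K : ℤ → ℝ)
    (τ0 τD m₁ m₂ : ℝ) (D L R : ℕ) (hL1 : 1 ≤ L) (hm₁ : 0 < m₁)
    (hsym : ∀ i j, W i j = W j i)
    (hband0 : ∀ i : Fin (N + 1),
      ∑ j : Fin (N + 1), (if ((0 : ℕ) : ℝ) < |(i.val : ℝ) - j.val| then |W i j| else 0) ≤ τ0)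
    (hbandD : ∀ i : Fin (N + 1),
      ∑ j : Fin (N + 1), (if (D : ℝ) < |(i.val : ℝ) - j.val| then |W i j| else 0) ≤ τD)
    (hbulk : ∀ i j : Fin (N + 1), R + 1 ≤ i.val → i.val + 1 + R ≤ N → R + 1 ≤ j.val → j.val + 1 + R ≤ N →
      i.val ≤ j.val + 2 * L → j.val ≤ i.val + 2 * L → |W i j - K ((i.val : ℤ) - j.val)| ≤ m₁ / (4 * L))
    (hToe : ∀ v : Fin (N + 1) → ℝ, m₁ * ∑ i, v i ^ 2 ≤ ∑ i, ∑ j, v i * K ((i.val : ℤ) - j.val) * v j)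
    (hcL : ∀ v : Fin (N + 1) → ℝ, (∀ i : Fin (N + 1), R + 1 + 2 * L ≤ i.val → v i = 0) →
      m₂ * ∑ i, v i ^ 2 ≤ ∑ i, ∑ j, v i * W i j * v j)
    (hcR : ∀ v : Fin (N + 1) → ℝ, (∀ i : Fin (N + 1), i.val + (R + 1 + 2 * L) < N + 1 → v i = 0) →
      m₂ * ∑ i, v i ^ 2 ≤ ∑ i, ∑ j, v i * W i j * v j)
    (hE : (D : ℝ) ^ 2 / (L : ℝ) ^ 2 * τ0 + τD ≤ min (m₁ / 2) m₂ / 10) :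
    ∀ ζ : Fin (N + 1) → ℝ, min (m₁ / 2) m₂ / 2 * ∑ i, ζ i ^ 2 ≤ ∑ i, ∑ j, ζ i * W i j * ζ j := by
  intro ζ
  have hLpos : (0 : ℝ) < L := by exact_mod_cast hL1
  -- the four inputs of the IMS step, with c := min (m₁/2) m₂ and E := (D²/L²)τ0 + τD
  have hwL : ∀ v : Fin (N + 1) → ℝ, (∀ i : Fin (N + 1), R + 1 + 2 * L ≤ i.val → v i = 0) →
      min (m₁ / 2) m₂ * ∑ i, v i ^ 2 ≤ ∑ i, ∑ j, v i * W i j * v j := by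
    intro v hv
    have hnn : 0 ≤ ∑ i, v i ^ 2 := Finset.sum_nonneg fun i _ => sq_nonneg _
    exact (mul_le_mul_of_nonneg_right (min_le_right _ _) hnn).trans (hcL v hv)
  have hwR : ∀ v : Fin (N + 1) → ℝ, (∀ i : Fin (N + 1), i.val + (R + 1 + 2 * L) < N + 1 → v i = 0) →
      min (m₁ / 2) m₂ * ∑ i, v i ^ 2 ≤ ∑ i, ∑ j, v i * W i j * v j := by
    intro v hv
    have hnn : 0 ≤ ∑ i, v i ^ 2 := Finset.sum_nonneg fun i _ => sq_nonneg _
    exact (mul_le_mul_of_nonneg_right (min_le_right _ _) hnn).trans (hcR v hv)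
  have hwB : ∀ a : ℕ, R + 1 ≤ a → a + 2 * L + (R + 1) ≤ N + 1 → ∀ v : Fin (N + 1) → ℝ,
      (∀ i : Fin (N + 1), i.val < a ∨ a + 2 * L ≤ i.val → v i = 0) →
      min (m₁ / 2) m₂ * ∑ i, v i ^ 2 ≤ ∑ i, ∑ j, v i * W i j * v j := by
    intro a ha haM v hv
    have hnn : 0 ≤ ∑ i, v i ^ 2 := Finset.sum_nonneg fun i _ => sq_nonneg _
    have hε : 0 ≤ m₁ / (4 * L) := by positivity
    have hent : ∀ i j : Fin (N + 1), a ≤ i.val → i.val < a + 2 * L → a ≤ j.val → j.val < a + 2 * L →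
        |W i j - K ((i.val : ℤ) - j.val)| ≤ m₁ / (4 * L) := fun i j hi1 hi2 hj1 hj2 =>
      hbulk i j (by omega) (by omega) (by omega) (by omega) (by omega) (by omega)
    have hwin := bulk_window W K m₁ (m₁ / (4 * L)) a L hToe hent hε v hv
    have hhalf : m₁ - 2 * L * (m₁ / (4 * L)) = m₁ / 2 := by
      field_simp
      ring
    rw [hhalf] at hwin
    exact (mul_le_mul_of_nonneg_right (min_le_left _ _) hnn).trans hwin
  have hwE : ∀ i : Fin (N + 1), ∑ j : Fin (N + 1), min 1 (((i.val : ℝ) - j.val) ^ 2 / (L : ℝ) ^ 2) * |W i j| ≤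
      (D : ℝ) ^ 2 / (L : ℝ) ^ 2 * τ0 + τD := fun i =>
    commutator_input W i D L hL1 τ0 τD (hband0 i) (hbandD i)
  have hIMS := stub_imsLocalisation (N + 1) (R + 1) L hL1 W hsym (min (m₁ / 2) m₂)
    ((D : ℝ) ^ 2 / (L : ℝ) ^ 2 * τ0 + τD) hwL hwR hwB hwE ζ
  have hnn : 0 ≤ ∑ i, ζ i ^ 2 := Finset.sum_nonneg fun i _ => sq_nonneg _
  have hhalf : min (m₁ / 2) m₂ / 2 ≤ min (m₁ / 2) m₂ - 5 * ((D : ℝ) ^ 2 / (L : ℝ) ^ 2 * τ0 + τD) := by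
    linarith
  exact (mul_le_mul_of_nonneg_right hhalf hnn).trans hIMS


end Summit.AtomisticToContinuum.FouriersLaw.Theorems.HonestZwanzig.Robin

end
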